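import Summits.AnomalousDissipation.AnomalousDissipation.Theorems.SolenoidalFractalHomogenisationLagrangianStepSidebandSlotDefs
import Summits.AnomalousDissipation.AnomalousDissipation.Theorems.SolenoidalFractalHomogenisationLagrangianStepSidebandConjFibre
import Summits.AnomalousDissipation.AnomalousDissipation.Theorems.SolenoidalFractalHomogenisationLagrangianStepCellLawVQSPinch
import Mathlib.Analysis.CStarAlgebra.Matrix
import Summits.AnomalousDissipation.AnomalousDissipation.Theorems.SolenoidalFractalHomogenisationLagrangianStepSidebandOwnSlotFeedback
import Mathlib.Analysis.Normed.Algebra.MatrixExponential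
import HarnessLib

/-!
# K1L_D `stub_D1_exactFamily` clause (i) (`stub_D1_residueTail`, registry v17) — brick A1(c)-III(c1): THE BLOCK GENERATOR IN COORDINATES —
# `blockGen (ν•S) γ₁ mⱼ` is the complexified real matrix `−4π²ν|mⱼ|²·P̂ Σ(S,m̂ⱼ) P̂ − γ₁ m̂ⱼm̂ⱼᵀ` (helper; `--supports stmt-AnomalousDissipation-27980`)

Summits-side helper file of route `SolenoidalFractalHomogenisation` (prover seat `ad-sawtooth-k1loc-p1` g12; variant A of D26-6/D26-7; identification
`diag psiStar = excQS`, `κ = 1`).  Everything proved; no definitions, no named facts, no sorry.  Writing `cmat A := Matrix.toEuclideanCLM (A.map (↑))`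
(an existing Mathlib equivalence, used inline) for the action of a real `3 × 3` matrix on `ℂ³`:
* `toEuclideanCLM_map_apply` — coordinates of `cmat A z`;  `map_ofReal_smul/_mul/_sub/_one` bookkeeping;
* `transversalProj_eq_cmat` — `P_{m} = cmat (projPerp m̂)` (`m̂ = mhat P` of a lattice phase);
* `symbT_majorTranspose_smul_eq_cmat` — `T_{(ν•S)ᵀ}(m) = cmat ((ν|m|²) • sigMat S m̂)`;
* **`blockGen_smul_eq_cmat`** — `blockGen (ν • S) γ₁ m = cmat (−(4π²ν|m|²) • (P̂ Σ̂ P̂) − γ₁ • vecMulVec m̂ m̂)` (using `1 − P̂ = m̂m̂ᵀ`).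
This is the dictionary between the sideband system (`ℂ³`-fibres, `transversalProj`, `symbT`) and the cell-law tensors (`regBlock = P̂Σ̂P̂ + m̂m̂ᵀ`,
`slotQ = qsResp (…) (regBlock S m̂) * projPerp m̂`); the semigroup identity `exp(u·B↾ℝ) P = cmat (exp(−(Tu)•regBlock) * projPerp)` follows in III(c2).
NOT a proof of any registered stub, of the crux, or of anomalous dissipation; rung leaf F-D1 infrastructure.
-/

set_option linter.dupNamespace false

noncomputable section

namespace Summit.AnomalousDissipation.AnomalousDissipation.Theorems.SolenoidalFractalHomogenisation.LagrangianStep.Sideband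

open Set Complex Matrix
open scoped InnerProductSpace
open Literature.Analysis Literature.Analysis.FunctionSpaces Literature.Analysis.FunctionSpaces.Torus
open Literature.Analysis.FluidPDE Literature.Analysis.FluidPDE.Torus Literature.Analysis.FluidPDE.LatticeShear

/-! ## §1 Real matrices acting on `ℂ³` -/

/-- Coordinates of the complexified action: `(cmat A z)_i = Σ_l A_{il} z_l`. [folklore] -/
theorem toEuclideanCLM_map_apply (A : Matrix (Fin 3) (Fin 3) ℝ) (z : EuclideanSpace ℂ (Fin 3)) (i : Fin 3) :
    Matrix.toEuclideanCLM (n := Fin 3) (𝕜 := ℂ) (A.map ((↑) : ℝ → ℂ)) z i = ∑ l, (A i l : ℂ) * z l := by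
  have h := congrFun (Matrix.ofLp_toEuclideanCLM (n := Fin 3) (𝕜 := ℂ) (A.map ((↑) : ℝ → ℂ)) z) i
  simp only [Matrix.mulVec, dotProduct, Matrix.map_apply] at h
  exact h

/-- `(c • A)` complexified is `(c : ℂ) •` the complexification. [folklore] -/
theorem map_ofReal_smul (c : ℝ) (A : Matrix (Fin 3) (Fin 3) ℝ) :
    (c • A).map ((↑) : ℝ → ℂ) = (c : ℂ) • A.map ((↑) : ℝ → ℂ) := by
  ext i j; simp

/-- Complexification is multiplicative. [folklore] -/
theorem map_ofReal_mul (A B : Matrix (Fin 3) (Fin 3) ℝ) :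
    (A * B).map ((↑) : ℝ → ℂ) = A.map ((↑) : ℝ → ℂ) * B.map ((↑) : ℝ → ℂ) :=
  Matrix.map_mul (f := Complex.ofRealHom)

/-- Complexification is additive (subtraction). [folklore] -/
theorem map_ofReal_sub (A B : Matrix (Fin 3) (Fin 3) ℝ) :
    (A - B).map ((↑) : ℝ → ℂ) = A.map ((↑) : ℝ → ℂ) - B.map ((↑) : ℝ → ℂ) := by
  ext i j; simp

/-- Complexification is additive. [folklore] -/
theorem map_ofReal_add (A B : Matrix (Fin 3) (Fin 3) ℝ) :
    (A + B).map ((↑) : ℝ → ℂ) = A.map ((↑) : ℝ → ℂ) + B.map ((↑) : ℝ → ℂ) := by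
  ext i j; simp

/-- Complexification of a negation. [folklore] -/
theorem map_ofReal_neg (A : Matrix (Fin 3) (Fin 3) ℝ) : (-A).map ((↑) : ℝ → ℂ) = -A.map ((↑) : ℝ → ℂ) := by
  ext i j; simp

/-- Complexification of the identity. [folklore] -/
theorem map_ofReal_one : (1 : Matrix (Fin 3) (Fin 3) ℝ).map ((↑) : ℝ → ℂ) = 1 := by
  ext i j
  by_cases h : i = j <;> simp [Matrix.one_apply, h]

/-! ## §2 The Leray projection and the symbol matrix at a lattice phase, in coordinates -/

/-- `|m|² ≠ 0` for a lattice phase, and `m̂ᵢ m̂ₗ |m|² = mᵢ mₗ`. [folklore] -/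
theorem norm_latticeVec_pos (P : LatticePhase) : 0 < ‖latticeVec P.m‖ := by
  refine norm_pos_iff.2 fun h => P.m_ne ?_
  funext i
  have hi := congrArg (fun v : EuclideanSpace ℝ (Fin 3) => v i) h
  simp only [latticeVec_apply, PiLp.zero_apply] at hi
  exact_mod_cast hi

/-- `|m|² = Σ mₐ²` (real coordinates). [folklore] -/
theorem norm_latticeVec_sq_eq_sum (P : LatticePhase) : ‖latticeVec P.m‖ ^ 2 = ∑ a, ((P.m a : ℝ)) ^ 2 := by
  rw [EuclideanSpace.norm_sq_eq]
  exact Finset.sum_congr rfl fun a _ => by rw [latticeVec_apply, Real.norm_eq_abs, sq_abs]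

/-- `freqNormSq m = |m|²` as a complex number. [folklore] -/
theorem freqNormSq_eq_norm_sq (P : LatticePhase) : (FunctionSpaces.Torus.freqNormSq P.m : ℂ) = ((‖latticeVec P.m‖ ^ 2 : ℝ) : ℂ) := by
  rw [norm_latticeVec_sq_eq_sum, FunctionSpaces.Torus.freqNormSq]

/-- `mᵢ = |m| · m̂ᵢ`. [folklore] -/
theorem coe_m_eq (P : LatticePhase) (i : Fin 3) : ((P.m i : ℝ)) = ‖latticeVec P.m‖ * mhat P i := by
  rw [mhat, latticeVec_apply, mul_div_cancel₀ _ (norm_latticeVec_pos P).ne']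

/-- **The Leray projection is the complexified `projPerp m̂`**: `P_m z = cmat (projPerp m̂) z`. [cite: Temam1984, Ch. III §1.1] -/
theorem transversalProj_eq_cmat (P : LatticePhase) (z : EuclideanSpace ℂ (Fin 3)) :
    transversalProj P.m z = Matrix.toEuclideanCLM (n := Fin 3) (𝕜 := ℂ) ((projPerp (mhat P)).map ((↑) : ℝ → ℂ)) z := by
  have hF : (FunctionSpaces.Torus.freqNormSq P.m : ℂ) ≠ 0 := by
    rw [freqNormSq_eq_norm_sq]; exact_mod_cast (pow_pos (norm_latticeVec_pos P) 2).ne'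
  ext i
  rw [toEuclideanCLM_map_apply, transversalProj_apply, PiLp.sub_apply, PiLp.smul_apply, waveVecC_apply, kdot_apply, smul_eq_mul]
  simp only [projPerp, Complex.ofReal_sub, sub_mul, Finset.sum_sub_distrib]
  have h1 : ∑ l, (((if i = l then (1:ℝ) else 0) : ℝ) : ℂ) * z l = z i := by
    rw [Finset.sum_eq_single i]
    · simp
    · intro l _ hl; simp [Ne.symm hl]
    · intro h; exact absurd (Finset.mem_univ i) h
  rw [h1]
  congr 1
  -- `(F⁻¹ Σₐ mₐ zₐ) mᵢ = Σₗ m̂ᵢ m̂ₗ zₗ`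
  have hm : ∀ a, ((P.m a : ℝ) : ℂ) = ((‖latticeVec P.m‖ : ℝ) : ℂ) * (mhat P a : ℂ) := fun a => by
    rw [coe_m_eq P a, Complex.ofReal_mul]
  have hcast : ∀ a, ((P.m a : ℤ) : ℂ) = ((P.m a : ℝ) : ℂ) := fun a => by norm_cast
  simp only [hcast, hm, Complex.ofReal_mul]
  rw [freqNormSq_eq_norm_sq, Finset.mul_sum, Finset.sum_mul]
  refine Finset.sum_congr rfl fun l _ => ?_
  have hn : ((‖latticeVec P.m‖ : ℝ) : ℂ) ≠ 0 := by exact_mod_cast (norm_latticeVec_pos P).ne'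
  field_simp
  push_cast
  ring

/-- **The symbol matrix at a lattice phase is the complexified `ν|m|²·sigMat S m̂`**: `T_{(ν•S)ᵀ}(m) z = cmat ((ν|m|²) • sigMat S m̂) z`.
[cite: Frisch1995Turbulence, §9.6.3 eq. (9.57) p. 233] -/
theorem symbT_majorTranspose_smul_eq_cmat (S : Torus.Visc4 (Fin 3)) (ν : ℝ) (P : LatticePhase) (z : EuclideanSpace ℂ (Fin 3)) :
    Torus.symbT (Torus.majorTranspose (ν • S)) P.m z =
      Matrix.toEuclideanCLM (n := Fin 3) (𝕜 := ℂ) (((ν * ‖latticeVec P.m‖ ^ 2) • sigMat S (mhat P)).map ((↑) : ℝ → ℂ)) z := by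
  ext j
  rw [toEuclideanCLM_map_apply, Torus.symbT_apply]
  refine Finset.sum_congr rfl fun i _ => ?_
  -- the coefficient of `z i`
  have hcoefR : ∑ a, ∑ b, Torus.majorTranspose (ν • S) i a j b * (P.m a : ℝ) * (P.m b : ℝ) =
      ((ν * ‖latticeVec P.m‖ ^ 2) • sigMat S (mhat P)) j i := by
    simp only [Torus.majorTranspose, Matrix.smul_apply, smul_eq_mul, sigMat, Finset.mul_sum]
    rw [Finset.sum_comm]
    refine Finset.sum_congr rfl fun a _ => Finset.sum_congr rfl fun b _ => ?_
    have e4 : (ν • S) j a i b = ν * S j a i b := rfl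
    rw [e4, coe_m_eq P a, coe_m_eq P b]
    ring
  have hcoef : ∑ a, ∑ b, ((Torus.majorTranspose (ν • S) i a j b * (P.m a : ℝ) * (P.m b : ℝ) : ℝ) : ℂ) =
      ((((ν * ‖latticeVec P.m‖ ^ 2) • sigMat S (mhat P)) j i : ℝ) : ℂ) := by
    rw [← hcoefR]
    push_cast
    rfl
  rw [← hcoef, Finset.sum_mul]
  refine Finset.sum_congr rfl fun a _ => ?_
  rw [Finset.sum_mul]

/-- `1 − projPerp m̂ = m̂ m̂ᵀ`. [folklore] -/
theorem one_sub_projPerp (n : Fin 3 → ℝ) : (1 : Matrix (Fin 3) (Fin 3) ℝ) - projPerp n = Matrix.vecMulVec n n := by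
  ext i j
  simp [projPerp, Matrix.vecMulVec_apply, Matrix.one_apply]

/-- **THE BLOCK GENERATOR IN COORDINATES**: for `𝔸 = ν • S` and a lattice phase `P` (`m = P.m`, `m̂ = mhat P`, `P̂ = projPerp m̂`, `Σ̂ = sigMat S m̂`):
`blockGen (ν • S) γ₁ m = cmat (−(4π²ν|m|²) • (P̂ Σ̂ P̂) − γ₁ • m̂m̂ᵀ)`. [cite: MajdaKramer1999, §2.2.1.3 (cell problem (49))] -/
theorem blockGen_smul_eq_cmat (S : Torus.Visc4 (Fin 3)) (ν γ₁ : ℝ) (P : LatticePhase) :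
    blockGen (ν • S) γ₁ P.m = Matrix.toEuclideanCLM (n := Fin 3) (𝕜 := ℂ)
      ((-(4 * Real.pi ^ 2 * ν * ‖latticeVec P.m‖ ^ 2) • (projPerp (mhat P) * sigMat S (mhat P) * projPerp (mhat P)) -
        γ₁ • Matrix.vecMulVec (mhat P) (mhat P)).map ((↑) : ℝ → ℂ)) := by
  ext z : 1
  have hc : ((((-(4 * Real.pi ^ 2 * ν * ‖latticeVec P.m‖ ^ 2)) : ℝ)) : ℂ) =
      -(((((4 * Real.pi ^ 2 : ℝ)) : ℂ)) * ((((ν * ‖latticeVec P.m‖ ^ 2 : ℝ)) : ℂ))) := by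
    push_cast; ring
  simp only [blockGen_apply, symbT_majorTranspose_smul_eq_cmat, transversalProj_eq_cmat]
  rw [← one_sub_projPerp]
  simp only [map_ofReal_sub, map_ofReal_smul, map_ofReal_one, map_ofReal_mul, hc]
  simp only [map_sub, map_smul, map_neg, map_mul, map_one, _root_.sub_apply, _root_.smul_apply, _root_.neg_apply, mul_apply_eq_comp,
    one_apply_eq_self, neg_smul, smul_smul]


/-! ## APPENDIX (amendment 1, same seat, same session): brick A1(c)-III(c2) — the own-slot block semigroup IS the cell-law matrix exponential:
`exp(u·B↾ℝ) P_m = cmat (exp(−(u·4π²ν|m|²)•regBlock S m̂) * projPerp m̂)` (`cmat_exp` via `NormedSpace.map_exp_of_mem_ball`; `exp(t•N)·Q = Q` when `N·Q = 0`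
by the derivative trick; `regBlock = P̂Σ̂P̂ + m̂m̂ᵀ` with `P̂Σ̂P̂·m̂m̂ᵀ = 0 = m̂m̂ᵀ·P̂Σ̂P̂`).  With `…SidebandOwnSlotFeedback.feedback_response_eq_of_mem_slot`,
`…SidebandMeanSlot.meanFeedback_eq_slot_integral` and the slot-time substitution (`L = MBτⱼ/ν`, `L·4π²ν|mⱼ|² = Tⱼ`) this identifies the own-slot kernel of
`M_{jj}` with the integrand of `slotQ = qsResp ρ Tⱼ (regBlock S m̂ⱼ) * projPerp m̂ⱼ`, i.e. `(ν/4π²)·M_{jj} = slotCoefⱼ·slotQⱼ + wrap` (`κ = 1`). -/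

section BlockExp

open NormedSpace

/-! ## §5 (appended) `cmat` commutes with the exponential -/

set_option backward.isDefEq.respectTransparency false in
/-- **`cmat (exp A) = exp (cmat A)`** for real `3 × 3` matrices (the complexified action is a continuous ring morphism). [folklore] -/
theorem cmat_exp (A : Matrix (Fin 3) (Fin 3) ℝ) :
    Matrix.toEuclideanCLM (n := Fin 3) (𝕜 := ℂ) ((NormedSpace.exp A).map ((↑) : ℝ → ℂ)) =
      NormedSpace.exp (Matrix.toEuclideanCLM (n := Fin 3) (𝕜 := ℂ) (A.map ((↑) : ℝ → ℂ))) := by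
  open scoped Matrix.Norms.Operator in
  letI : Algebra ℚ (EuclideanSpace ℂ (Fin 3) →L[ℂ] EuclideanSpace ℂ (Fin 3)) :=
    RingHom.toAlgebra' ((algebraMap ℂ (EuclideanSpace ℂ (Fin 3) →L[ℂ] EuclideanSpace ℂ (Fin 3))).comp (algebraMap ℚ ℂ))
      (fun c x => Algebra.commutes _ _)
  let φ : Matrix (Fin 3) (Fin 3) ℝ →+* (EuclideanSpace ℂ (Fin 3) →L[ℂ] EuclideanSpace ℂ (Fin 3)) :=
    ((Matrix.toEuclideanCLM (n := Fin 3) (𝕜 := ℂ)).toRingEquiv.toRingHom).comp (Complex.ofRealHom.mapMatrix)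
  have hφapply : ∀ B : Matrix (Fin 3) (Fin 3) ℝ, φ B = Matrix.toEuclideanCLM (n := Fin 3) (𝕜 := ℂ) (B.map ((↑) : ℝ → ℂ)) := fun B => rfl
  have hφc : Continuous φ := by
    have h1 : Continuous fun B : Matrix (Fin 3) (Fin 3) ℝ => B.map ((↑) : ℝ → ℂ) := continuous_id.matrix_map Complex.continuous_ofReal
    have h2 : Continuous fun C : Matrix (Fin 3) (Fin 3) ℂ => Matrix.toEuclideanCLM (n := Fin 3) (𝕜 := ℂ) C := by
      let Lm : Matrix (Fin 3) (Fin 3) ℂ →ₗ[ℂ] (EuclideanSpace ℂ (Fin 3) →L[ℂ] EuclideanSpace ℂ (Fin 3)) :=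
        { toFun := fun C => Matrix.toEuclideanCLM (n := Fin 3) (𝕜 := ℂ) C
          map_add' := fun C D => map_add _ C D
          map_smul' := fun c C => map_smul _ c C }
      exact Lm.continuous_of_finiteDimensional
    exact h2.comp h1
  have h := map_exp_of_mem_ball (𝕂 := ℝ) φ hφc A (by simp [expSeries_radius_eq_top])
  rw [hφapply, hφapply] at h
  exact h

/-- `cmat (u • A) = (u : ℂ) • cmat A`. [folklore] -/
theorem cmat_smul (u : ℝ) (A : Matrix (Fin 3) (Fin 3) ℝ) :
    Matrix.toEuclideanCLM (n := Fin 3) (𝕜 := ℂ) ((u • A).map ((↑) : ℝ → ℂ)) = (u : ℂ) • Matrix.toEuclideanCLM (n := Fin 3) (𝕜 := ℂ) (A.map ((↑) : ℝ → ℂ)) := by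
  rw [map_ofReal_smul, map_smul]

/-! ## §6 (appended) The real `3 × 3` identities -/

/-- `P̂ P̂ = P̂` for a unit vector. [folklore] -/
theorem projPerp_mul_projPerp {n : Fin 3 → ℝ} (hn : ∑ a, n a ^ 2 = 1) : projPerp n * projPerp n = projPerp n := by
  ext i j
  simp only [Matrix.mul_apply, projPerp]
  have h : ∀ l, ((if i = l then (1:ℝ) else 0) - n i * n l) * ((if l = j then 1 else 0) - n l * n j) =
      (if i = l then (1:ℝ) else 0) * (if l = j then 1 else 0) - (if i = l then (1:ℝ) else 0) * (n l * n j) - n i * (n l * (if l = j then 1 else 0)) +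
        n i * n j * n l ^ 2 := fun l => by ring
  simp only [h, Finset.sum_add_distrib, Finset.sum_sub_distrib, ← Finset.mul_sum, hn]
  simp only [Finset.sum_ite_eq, Finset.sum_ite_eq', Finset.mem_univ, if_true, ite_mul, one_mul, zero_mul, mul_ite, mul_one, mul_zero,
    Finset.sum_ite_eq', Finset.mem_univ, if_true]
  split_ifs <;> ring

/-- `m̂m̂ᵀ P̂ = 0` for a unit vector. [folklore] -/
theorem vecMulVec_mul_projPerp {n : Fin 3 → ℝ} (hn : ∑ a, n a ^ 2 = 1) : Matrix.vecMulVec n n * projPerp n = 0 := by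
  rw [← one_sub_projPerp, sub_mul, one_mul, projPerp_mul_projPerp hn, sub_self]

/-- `P̂ m̂m̂ᵀ = 0` for a unit vector. [folklore] -/
theorem projPerp_mul_vecMulVec {n : Fin 3 → ℝ} (hn : ∑ a, n a ^ 2 = 1) : projPerp n * Matrix.vecMulVec n n = 0 := by
  rw [← one_sub_projPerp, mul_sub, mul_one, projPerp_mul_projPerp hn, sub_self]

set_option backward.isDefEq.respectTransparency false in
/-- **`exp(t • N) * P̂ = P̂` whenever `N * P̂ = 0`** (the derivative of `t ↦ exp(t•N) P̂` is `exp(t•N) (N P̂) = 0`). [folklore] -/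
theorem exp_smul_mul_eq_of_mul_eq_zero {N Q : Matrix (Fin 3) (Fin 3) ℝ} (h : N * Q = 0) (t : ℝ) : NormedSpace.exp (t • N) * Q = Q := by
  open scoped Matrix.Norms.Operator in
  have hd : ∀ s, HasDerivAt (fun s : ℝ => NormedSpace.exp (s • N) * Q) 0 s := by
    intro s
    have h1 := (hasDerivAt_exp_smul_const (𝕂 := ℝ) N s).mul_const Q
    rw [mul_assoc, h, mul_zero] at h1
    exact h1
  have hconst := is_const_of_deriv_eq_zero (f := fun s : ℝ => NormedSpace.exp (s • N) * Q) (fun s => (hd s).differentiableAt)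
    (fun s => (hd s).deriv) t 0
  simp only [zero_smul, NormedSpace.exp_zero, one_mul] at hconst
  exact hconst

set_option backward.isDefEq.respectTransparency false in
/-- **The block exponential on the transverse range**: with `K = P̂Σ̂P̂`, `N = m̂m̂ᵀ` (unit `m̂`) and real `c, γ₁, u`,
`exp(u • (−c•K − γ₁•N)) * P̂ = exp(−(u c) • (K + N)) * P̂` (`K + N = regBlock S m̂`). [folklore] -/
theorem exp_blockMatrix_mul_projPerp (S : Torus.Visc4 (Fin 3)) {n : Fin 3 → ℝ} (hn : ∑ a, n a ^ 2 = 1) (c γ₁ u : ℝ) :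
    NormedSpace.exp (u • (-c • (projPerp n * sigMat S n * projPerp n) - γ₁ • Matrix.vecMulVec n n)) * projPerp n =
      NormedSpace.exp (-(u * c) • regBlock S n) * projPerp n := by
  open scoped Matrix.Norms.Operator in
  set K := projPerp n * sigMat S n * projPerp n with hK
  set N := Matrix.vecMulVec n n with hN
  have hKN : K * N = 0 := by rw [hK, mul_assoc, projPerp_mul_vecMulVec hn, mul_zero]
  have hNK : N * K = 0 := by rw [hK, ← mul_assoc, ← mul_assoc, vecMulVec_mul_projPerp hn, zero_mul, zero_mul]
  have hNP : N * projPerp n = 0 := vecMulVec_mul_projPerp hn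
  have hcomm : ∀ a b : ℝ, Commute (a • K) (b • N) := fun a b => by
    show a • K * (b • N) = b • N * (a • K)
    simp only [Matrix.smul_mul, Matrix.mul_smul, hKN, hNK, smul_zero]
  have hreg : regBlock S n = K + N := rfl
  have e1 : u • (-c • K - γ₁ • N) = (-(u * c)) • K + (-(u * γ₁)) • N := by
    rw [smul_sub, smul_smul, smul_smul, sub_eq_add_neg, ← neg_smul, mul_neg]
  have e2 : -(u * c) • regBlock S n = (-(u * c)) • K + (-(u * c)) • N := by rw [hreg, smul_add]
  rw [e1, e2, Matrix.exp_add_of_commute _ _ (hcomm _ _), Matrix.exp_add_of_commute _ _ (hcomm _ _), mul_assoc, mul_assoc,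
    exp_smul_mul_eq_of_mul_eq_zero hNP, exp_smul_mul_eq_of_mul_eq_zero hNP]

/-! ## §7 (appended) The own-slot block semigroup is the cell-law matrix exponential -/

/-- **`exp(u·B↾ℝ) P_m = cmat (exp(−(u·4π²ν|m|²) • regBlock S m̂) * projPerp m̂)`** for `𝔸 = ν • S` and a lattice phase `P` (`m = P.m`, `m̂ = mhat P`).
[cite: MajdaKramer1999, §2.2.1.3 (cell problem (49))] [cite: Hale1980, Ch. III §1, Theorem 1.1] -/
theorem exp_blockGen_transversalProj (S : Torus.Visc4 (Fin 3)) (ν γ₁ : ℝ) (P : LatticePhase) (u : ℝ) (z : EuclideanSpace ℂ (Fin 3)) :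
    NormedSpace.exp (u • (blockGen (ν • S) γ₁ P.m).restrictScalars ℝ) (transversalProj P.m z) =
      Matrix.toEuclideanCLM (n := Fin 3) (𝕜 := ℂ)
        ((NormedSpace.exp (-(u * (4 * Real.pi ^ 2 * ν * ‖latticeVec P.m‖ ^ 2)) • regBlock S (mhat P)) * projPerp (mhat P)).map ((↑) : ℝ → ℂ)) z := by
  rw [exp_smul_restrictScalars, ContinuousLinearMap.coe_restrictScalars', blockGen_smul_eq_cmat, ← cmat_smul, ← cmat_exp, transversalProj_eq_cmat,
    ← mul_apply_eq_comp, ← map_mul, ← map_ofReal_mul, exp_blockMatrix_mul_projPerp S (sum_mhat_sq P)]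

end BlockExp

end Summit.AnomalousDissipation.AnomalousDissipation.Theorems.SolenoidalFractalHomogenisation.LagrangianStep.Sideband
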